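import Mathlib
import Literature.Barriers.ValiantsHypothesis.AlgebraicNaturalProofs
import Literature.Computability.AlgebraicComplexity.ArithCircuitProofs
import HarnessLib

/-!
# Crux `BarrierLever.SuccinctHittingSetsForVP` (stmt-ValiantsHypothesis-14610), line `registered` —
LOW-DEGREE DISTINGUISHERS ARE HIT (tightness of the open stub `stub_levelOne` in the degree)

**What is proved (unconditional; structure of the open stub, it does NOT close the item).**
In FSV's framework over `ℂ` (tree regime `d = n`, coefficient variables indexed by
`degLEMonomials n`, simple class `SmallCircuits ℂ n b = {f : deg f ≤ n, L(f) ≤ n^b}`):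

* `isSuccinctHittingSet_totalDegree_le` : if `t · (2n + 2) ≤ n ^ b` then the coefficient vectors of
  `SmallCircuits ℂ n b` hit EVERY nonzero polynomial `D` in the coefficient variables of total
  degree `≤ t` — whatever its circuit size;
* `isSuccinctHittingSet_totalDegree_le_pow` : in particular `SmallCircuits ℂ n (c + 2)` hits all
  nonzero `D` with `deg D ≤ n ^ c` (`n ≥ 3`);
* `stub_levelOne_lowDegree` (registered stub on the crux item): level one of FSV Question 6
  restricted to distinguishers of degree `≤ n ^ c` holds for every `c` — the settled part of the
  open stub `stub_levelOne`;
* `totalDegree_gt_of_vanishes` / `IsNaturalProof.pow_lt_totalDegree` : dually, a nonzero `D` that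
  vanishes on (the coefficient vectors of) all of `SmallCircuits ℂ n b`, `n ≥ 3` — an algebraically
  natural proof against size `n^b` in the sense of FSV Def. 1, of ANY constructivity — has total
  degree `> n ^ (b - 2)`.

So in the open stub `stub_levelOne` (= FSV Question 6 at level one: distinguishers of size AND
degree `≤ N = C(2n,n)`) the degree allowance `N` cannot be lowered to `polylog(N) = poly(n)`
without making the statement trivially true, and every candidate equation for `VP` in this regime
(CKRST-type or otherwise) must have degree polynomially large in `n`.

**Proof.** A nonzero `D` of total degree `≤ t` has a monomial `m₀` with `|supp m₀| ≤ t`; setting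
the variables outside `S = supp m₀` to zero leaves a NONZERO polynomial (the coefficient of `m₀`
survives, `coeff_subst_self`), which over the infinite field `ℂ` has a non-root
(`MvPolynomial.funext`); so `D(w) ≠ 0` for a point `w` supported on `≤ t` coordinates
(`exists_sparse_eval_ne_zero`). The `t`-sparse vector `w` is the coefficient vector of the
`t`-sparse polynomial `f = Σ_{μ ∈ S} w_μ x^μ` of degree `≤ n`, and `L(x^μ) ≤ 2 |μ| ≤ 2n`,
`L(f) ≤ |S| (2n + 2)` (`complexity_sparse_le`). Axioms: `propext`, `Classical.choice`, `Quot.sound`.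

References: [ForbesShpilkaVolk2018] Def. 1, Def. 3, Question 6 (framework); the sparse-support
argument is folklore (cf. the trivial hitting sets for low-degree sparse evaluation).
-/

-- layout Summits/ValiantsHypothesis/ValiantsHypothesis forces the duplicated namespace component
set_option linter.dupNamespace false

namespace Summit.ValiantsHypothesis.ValiantsHypothesis.Theorems.BarrierLever.SuccinctHittingSetsForVP

open Literature.Barriers.ValiantsHypothesis Literature.Computability.AlgebraicComplexity MvPolynomial

namespace LowDegree

section Sparse

variable {ι : Type*} [DecidableEq ι]

/-! Setting the variables outside `S` to zero is the substitution
`aeval (fun i => if i ∈ S then X i else 0)` (`X i ↦ X i` for `i ∈ S`, `X i ↦ 0` otherwise);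
it is spelled out in each statement (no auxiliary definition). -/

/-- On a monomial supported inside `S` the substitution is the identity. [folklore] -/
theorem subst_monomial_of_subset (S : Finset ι) {m : ι →₀ ℕ} (hm : m.support ⊆ S) (c : ℂ) :
    aeval (fun i => if i ∈ S then (X i : MvPolynomial ι ℂ) else 0) (monomial m c) = monomial m c := by
  classical
  rw [aeval_monomial, Finsupp.prod]
  have : ∏ i ∈ m.support, (if i ∈ S then (X i : MvPolynomial ι ℂ) else 0) ^ m i =
      ∏ i ∈ m.support, X i ^ m i :=
    Finset.prod_congr rfl fun i hi => by rw [if_pos (hm hi)]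
  rw [this, prod_X_pow_eq_monomial, MvPolynomial.algebraMap_eq, C_mul_monomial, mul_one]

/-- A monomial using a variable outside `S` is killed. [folklore] -/
theorem subst_monomial_of_not_subset (S : Finset ι) {m : ι →₀ ℕ} (hm : ¬ m.support ⊆ S)
    (c : ℂ) : aeval (fun i => if i ∈ S then (X i : MvPolynomial ι ℂ) else 0) (monomial m c) = 0 := by
  classical
  rw [aeval_monomial, Finsupp.prod]
  obtain ⟨i, hi, hiS⟩ := Finset.not_subset.mp hm
  rw [Finset.prod_eq_zero hi, mul_zero]
  rw [if_neg hiS, zero_pow (Finsupp.mem_support_iff.mp hi)]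

/-- The coefficient of a monomial supported inside `S` survives the substitution. [folklore] -/
theorem coeff_subst_self (S : Finset ι) (D : MvPolynomial ι ℂ) {m₀ : ι →₀ ℕ}
    (hm₀ : m₀.support ⊆ S) :
    coeff m₀ (aeval (fun i => if i ∈ S then (X i : MvPolynomial ι ℂ) else 0) D) = coeff m₀ D := by
  classical
  conv_lhs => rw [D.as_sum, map_sum]
  rw [coeff_sum, Finset.sum_eq_single m₀]
  · rw [subst_monomial_of_subset S hm₀, coeff_monomial, if_pos rfl]
  · intro m _ hne
    by_cases hm : m.support ⊆ S
    · rw [subst_monomial_of_subset S hm, coeff_monomial, if_neg hne]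
    · rw [subst_monomial_of_not_subset S hm, coeff_zero]
  · intro hnot
    rw [notMem_support_iff.mp hnot, monomial_zero, map_zero, coeff_zero]

/-- Evaluating the substituted polynomial at `w'` is evaluating the original at the point `w'`
cut down to `S`. [folklore] -/
theorem eval_subst (S : Finset ι) (D : MvPolynomial ι ℂ) (w' : ι → ℂ) :
    eval w' (aeval (fun i => if i ∈ S then (X i : MvPolynomial ι ℂ) else 0) D) =
      eval (fun i => if i ∈ S then w' i else 0) D := by
  have key : (eval w').comp (aeval (fun i => if i ∈ S then (X i : MvPolynomial ι ℂ) else 0) :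
        MvPolynomial ι ℂ →ₐ[ℂ] MvPolynomial ι ℂ).toRingHom =
      eval (fun i => if i ∈ S then w' i else 0) := by
    refine MvPolynomial.ringHom_ext (fun c => by simp) (fun i => ?_)
    simp only [RingHom.comp_apply, AlgHom.toRingHom_eq_coe, AlgHom.coe_toRingHom,
      aeval_X, eval_X]
    split_ifs <;> simp
  exact RingHom.congr_fun key D

/-- **Sparse non-roots.** A nonzero polynomial over `ℂ` of total degree `≤ t` (in any set of
variables) is nonzero at some point supported on at most `t` coordinates: restrict to the
support of one of its monomials. [folklore] -/
theorem exists_sparse_eval_ne_zero {D : MvPolynomial ι ℂ} (hD : D ≠ 0) :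
    ∃ (S : Finset ι) (w : ι → ℂ), S.card ≤ D.totalDegree ∧ (∀ i, i ∉ S → w i = 0) ∧
      eval w D ≠ 0 := by
  classical
  obtain ⟨m₀, hm₀⟩ := exists_coeff_ne_zero hD
  refine ⟨m₀.support, ?_⟩
  have hdeg : m₀.support.card ≤ D.totalDegree := by
    have h1 : m₀.support.card ≤ m₀.sum fun _ e => e := by
      rw [Finsupp.sum, Finset.card_eq_sum_ones]
      exact Finset.sum_le_sum fun i hi => Nat.one_le_iff_ne_zero.mpr (Finsupp.mem_support_iff.mp hi)
    exact h1.trans (le_totalDegree (mem_support_iff.mpr hm₀))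
  have hne : aeval (fun i => if i ∈ m₀.support then (X i : MvPolynomial ι ℂ) else 0) D ≠ 0 := by
    intro h0
    have := coeff_subst_self m₀.support D (subset_refl _)
    rw [h0, coeff_zero] at this
    exact hm₀ this.symm
  obtain ⟨w', hw'⟩ :
      ∃ w', eval w' (aeval (fun i => if i ∈ m₀.support then (X i : MvPolynomial ι ℂ) else 0) D) ≠ 0 := by
    by_contra hcon
    push Not at hcon
    exact hne (MvPolynomial.funext fun v => by simpa using hcon v)
  refine ⟨fun i => if i ∈ m₀.support then w' i else 0, hdeg, fun i hi => if_neg hi, ?_⟩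
  rwa [eval_subst] at hw'

end Sparse

section Complexity

variable {n : ℕ}

/-- `L(0) = 0`. [cite: Burgisser2000, Def. 2.1] -/
theorem complexity_zero : complexity (0 : MvPolynomial (Fin n) ℂ) = 0 := by
  simpa using complexity_C_holds (σ := Fin n) (0 : ℂ)

/-- `L(1) = 0`. [cite: Burgisser2000, Def. 2.1] -/
theorem complexity_one : complexity (1 : MvPolynomial (Fin n) ℂ) = 0 := by
  simpa using complexity_C_holds (σ := Fin n) (1 : ℂ)

/-- `L(x_i ^ e) ≤ e` (repeated multiplication, variables free). [cite: Burgisser2000, §2.1] -/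
theorem complexity_X_pow_le (i : Fin n) (e : ℕ) :
    complexity ((X i : MvPolynomial (Fin n) ℂ) ^ e) ≤ e := by
  induction e with
  | zero => rw [pow_zero, complexity_one]
  | succ e ih =>
    rw [pow_succ]
    calc complexity ((X i : MvPolynomial (Fin n) ℂ) ^ e * X i)
        ≤ complexity ((X i : MvPolynomial (Fin n) ℂ) ^ e) + complexity (X i : MvPolynomial (Fin n) ℂ) + 1 :=
          complexity_mul_le_holds _ _
      _ ≤ e + 0 + 1 := by rw [complexity_X_holds]; omega
      _ = e + 1 := by ring

/-- `L(c · x^μ) ≤ 2 |μ| + 1`: the product of the `|supp μ| ≤ |μ|` prime powers `x_i^{μ_i}`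
(`Σ μ_i` gates for the powers, one per factor), times the free constant.
[cite: Burgisser2000, §2.1] -/
theorem complexity_monomial_le (μ : Fin n →₀ ℕ) (c : ℂ) :
    complexity (monomial μ c : MvPolynomial (Fin n) ℂ) ≤ 2 * μ.degree + 1 := by
  classical
  rw [monomial_eq, Finsupp.prod]
  have hprod : complexity (∏ i ∈ μ.support, (X i : MvPolynomial (Fin n) ℂ) ^ μ i) ≤ 2 * μ.degree := by
    calc complexity (∏ i ∈ μ.support, (X i : MvPolynomial (Fin n) ℂ) ^ μ i)
        ≤ ∑ i ∈ μ.support, complexity ((X i : MvPolynomial (Fin n) ℂ) ^ μ i) + μ.support.card :=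
          complexity_finset_prod_le _ _
      _ ≤ ∑ i ∈ μ.support, μ i + ∑ i ∈ μ.support, μ i := by
          gcongr with i hi
          · exact complexity_X_pow_le i (μ i)
          · rw [Finset.card_eq_sum_ones]
            exact Finset.sum_le_sum fun i hi =>
              Nat.one_le_iff_ne_zero.mpr (Finsupp.mem_support_iff.mp hi)
      _ = 2 * μ.degree := by rw [Finsupp.degree_apply, two_mul]
  calc complexity (C c * ∏ i ∈ μ.support, (X i : MvPolynomial (Fin n) ℂ) ^ μ i)
      ≤ complexity (C c : MvPolynomial (Fin n) ℂ) +
          complexity (∏ i ∈ μ.support, (X i : MvPolynomial (Fin n) ℂ) ^ μ i) + 1 :=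
        complexity_mul_le_holds _ _
    _ ≤ 0 + 2 * μ.degree + 1 := by rw [complexity_C_holds]; omega
    _ = 2 * μ.degree + 1 := by ring

/-- **Sparse polynomials are cheap**: `L(Σ_{μ ∈ S} w_μ x^μ) ≤ |S| · (2n + 2)` when every exponent
vector in `S` has degree `≤ n`. [cite: Burgisser2000, §2.1] -/
theorem complexity_sparse_le (S : Finset (degLEMonomials n)) (w : degLEMonomials n → ℂ) :
    complexity (∑ μ ∈ S, (monomial (μ : Fin n →₀ ℕ) (w μ) : MvPolynomial (Fin n) ℂ)) ≤
      S.card * (2 * n + 2) := by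
  calc complexity (∑ μ ∈ S, (monomial (μ : Fin n →₀ ℕ) (w μ) : MvPolynomial (Fin n) ℂ))
      ≤ ∑ μ ∈ S, complexity (monomial (μ : Fin n →₀ ℕ) (w μ) : MvPolynomial (Fin n) ℂ) + S.card :=
        complexity_finset_sum_le _ _
    _ ≤ ∑ μ ∈ S, (2 * n + 1) + S.card := by
        gcongr with μ hμ
        refine (complexity_monomial_le _ _).trans ?_
        have : (μ : Fin n →₀ ℕ).degree ≤ n := μ.2
        omega
    _ = S.card * (2 * n + 2) := by rw [Finset.sum_const, smul_eq_mul]; ring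

end Complexity

section Hitting

variable {n : ℕ}

/-! The hitting polynomials are the sparse polynomials `Σ_{μ ∈ S} w_μ x^μ` with prescribed
coefficients `w` on a finite set `S` of degree-`≤ n` exponent vectors (spelled out in each
statement, no auxiliary definition). -/

/-- The coefficient vector of `Σ_{μ ∈ S} w_μ x^μ` on the degree-`≤ n` monomials is `w`, provided
`w` vanishes off `S`. [folklore] -/
theorem coeffVector_sparse (S : Finset (degLEMonomials n)) {w : degLEMonomials n → ℂ}
    (hw : ∀ μ, μ ∉ S → w μ = 0) :
    coeffVector (degLEMonomials n)
      (∑ μ ∈ S, (monomial (μ : Fin n →₀ ℕ) (w μ) : MvPolynomial (Fin n) ℂ)) = w := by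
  classical
  funext m
  rw [coeffVector_apply, coeff_sum]
  by_cases hm : m ∈ S
  · rw [Finset.sum_eq_single_of_mem m hm]
    · rw [coeff_monomial, if_pos rfl]
    · intro μ _ hne
      rw [coeff_monomial, if_neg (fun h => hne (Subtype.ext h))]
  · rw [hw m hm]
    refine Finset.sum_eq_zero fun μ hμ => ?_
    rw [coeff_monomial, if_neg]
    intro h
    exact hm (Subtype.ext h ▸ hμ)

/-- `Σ_{μ ∈ S} w_μ x^μ` has degree `≤ n`. [folklore] -/
theorem totalDegree_sparse_le (S : Finset (degLEMonomials n)) (w : degLEMonomials n → ℂ) :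
    (∑ μ ∈ S, (monomial (μ : Fin n →₀ ℕ) (w μ) : MvPolynomial (Fin n) ℂ)).totalDegree ≤ n := by
  refine totalDegree_finsetSum_le fun μ _ => (totalDegree_monomial_le _ _).trans ?_
  exact μ.2

/-- `Σ_{μ ∈ S} w_μ x^μ` is a small circuit as soon as `|S| (2n + 2) ≤ n ^ b`.
[cite: Burgisser2000, §2.1] -/
theorem sparse_mem_smallCircuits (S : Finset (degLEMonomials n)) (w : degLEMonomials n → ℂ)
    {b : ℕ} (h : S.card * (2 * n + 2) ≤ n ^ b) :
    (∑ μ ∈ S, (monomial (μ : Fin n →₀ ℕ) (w μ) : MvPolynomial (Fin n) ℂ)) ∈ SmallCircuits ℂ n b :=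
  ⟨totalDegree_sparse_le S w, (complexity_sparse_le S w).trans h⟩

end Hitting

end LowDegree

open LowDegree

/-- **Low-degree distinguishers are hit, whatever their size.** If `t · (2n + 2) ≤ n ^ b`, the
coefficient vectors of `SmallCircuits ℂ n b` (degree `≤ n`, fan-in-two size `≤ n ^ b`) form a
hitting set for ALL nonzero polynomials of total degree `≤ t` in the `C(2n,n)` coefficient
variables (no bound on their circuit size): sparse polynomials with `≤ t` monomials suffice.
[cite: ForbesShpilkaVolk2018, Def. 3 and Question 6] -/
theorem isSuccinctHittingSet_totalDegree_le {n t b : ℕ} (h : t * (2 * n + 2) ≤ n ^ b) :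
    IsSuccinctHittingSet (degLEMonomials n) (SmallCircuits ℂ n b)
      {D : MvPolynomial (degLEMonomials n) ℂ | D.totalDegree ≤ t} := by
  intro D hD hD0
  obtain ⟨S, w, hS, hw, hne⟩ := exists_sparse_eval_ne_zero hD0
  refine ⟨∑ μ ∈ S, monomial (μ : Fin n →₀ ℕ) (w μ), sparse_mem_smallCircuits S w ?_, ?_⟩
  · exact le_trans (Nat.mul_le_mul_right _ (hS.trans hD)) h
  · rwa [coeffVector_sparse S hw]

/-- **Polynomial form**: for `n ≥ 3`, `SmallCircuits ℂ n (c + 2)` hits every nonzero polynomial of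
total degree `≤ n ^ c` in the coefficient variables. [cite: ForbesShpilkaVolk2018, Question 6] -/
theorem isSuccinctHittingSet_totalDegree_le_pow {n : ℕ} (c : ℕ) (hn : 3 ≤ n) :
    IsSuccinctHittingSet (degLEMonomials n) (SmallCircuits ℂ n (c + 2))
      {D : MvPolynomial (degLEMonomials n) ℂ | D.totalDegree ≤ n ^ c} := by
  refine isSuccinctHittingSet_totalDegree_le ?_
  calc n ^ c * (2 * n + 2) ≤ n ^ c * (n * n) := Nat.mul_le_mul_left _ (by nlinarith)
    _ = n ^ (c + 2) := by ring

/-- **Degree lower bound for equations of small circuits.** For `n ≥ 3` and `b ≥ 2`, a nonzero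
polynomial in the coefficient variables vanishing at the coefficient vector of every
`f ∈ SmallCircuits ℂ n b` has total degree `> n ^ (b - 2)`. (For `b ≤ 1` nothing of the sort holds:
the single coefficient `c_m` of a monomial `m` needing two gates is a degree-one equation.) [cite: ForbesShpilkaVolk2018, Def. 1 and Question 6] -/
theorem totalDegree_gt_of_vanishes {n b : ℕ} (hn : 3 ≤ n) (hb : 2 ≤ b)
    {D : MvPolynomial (degLEMonomials n) ℂ} (hD0 : D ≠ 0)
    (hvan : ∀ f ∈ SmallCircuits ℂ n b, eval (coeffVector (degLEMonomials n) f) D = 0) :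
    n ^ (b - 2) < D.totalDegree := by
  by_contra hle
  push Not at hle
  have hb2 : b - 2 + 2 = b := by omega
  obtain ⟨f, hf, hne⟩ := isSuccinctHittingSet_totalDegree_le_pow (b - 2) hn D hle hD0
  rw [hb2] at hf
  exact hne (hvan f hf)

/-- **Natural proofs against `VP` have polynomially large degree**: for `n ≥ 3`, an algebraically
natural proof `D` against `SmallCircuits ℂ n b` (FSV Def. 1, for ANY distinguisher class `𝒟`)
satisfies `n ^ (b - 2) < deg D` (`b ≥ 2`). [cite: ForbesShpilkaVolk2018, Def. 1] -/
theorem IsNaturalProof.pow_lt_totalDegree {n b : ℕ} (hn : 3 ≤ n) (hb : 2 ≤ b)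
    {𝒟 : Set (MvPolynomial (degLEMonomials n) ℂ)} {D : MvPolynomial (degLEMonomials n) ℂ}
    (hD : IsNaturalProof (degLEMonomials n) (SmallCircuits ℂ n b) 𝒟 D) :
    n ^ (b - 2) < D.totalDegree :=
  totalDegree_gt_of_vanishes hn hb hD.2.1 hD.2.2

/-- **Registered stub `stub_levelOne_lowDegree`** (crux stmt-ValiantsHypothesis-14610, line
`registered`; the SETTLED PART of the open stub `stub_levelOne`): FSV Question 6 at level one holds
against the level-one distinguishers of total degree `≤ n ^ c`, for every `c` (with `b = c + 2`,
`n₀ = 3`) — indeed against all nonzero polynomials of that degree, of any size. What remains open in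
`stub_levelOne` is exactly the range `n ^ c < deg D ≤ N = C(2n,n)` together with the size bound
`L(D) ≤ N`. [cite: ForbesShpilkaVolk2018, Question 6] -/
theorem stub_levelOne_lowDegree :
    ∀ c : ℕ, ∃ b n₀ : ℕ, ∀ n : ℕ, n₀ ≤ n →
      IsSuccinctHittingSet (degLEMonomials n) (SmallCircuits ℂ n b)
        (Distinguishers ℂ n 1 ∩ {D | D.totalDegree ≤ n ^ c}) :=
  fun c => ⟨c + 2, 3, fun _ hn =>
    (isSuccinctHittingSet_totalDegree_le_pow c hn).mono le_rfl Set.inter_subset_right⟩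

end Summit.ValiantsHypothesis.ValiantsHypothesis.Theorems.BarrierLever.SuccinctHittingSetsForVP
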